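import Mathlib
import HarnessLib.Audit
import Summits.PneNP.PneNP.Theorems.PstarCentreGateBudget
import Summits.PneNP.PneNP.Theorems.PstarSkeletonPartsSum

/-!
# The gate budget for XOR-disconnected cores (ROUND-24, O1; every slack, all sharing patterns; memo g25 §54)

FRONTIER range-avoidance ladder, rung F-N3, ROUND 24 (cell `pnp-ideate`, prover-2 memo `g25/O1-XORSPLIT-g25.md` §54; typed targets
`PstarCoreBoundTargets.TerminalFive` / `TerminalPeelable` (p646951); restricted-model proof complexity — nothing here bears on `P` versus `NP`).

`PstarCentreGateBudget.centre_gate_budget` assumes the core X-connected (only for the vertex bound `#(xverts K ∖ xverts S) + #S ≤ #skel`).  With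
`PstarSkeletonPartsSum.card_xverts_sdiff_add_le_parts` the same count runs over any partition of the core into separated X-connected parts (its XOR
components), each part missing the centre costing one vertex:

* **`centre_gate_budget_parts`** — inside the core-bound induction, for a terminal core `K` with centre `S`, inside gates `H`, `D ⊇` dirty chords, doubly
  shared `N₀`, and a partition `parts` into separated X-connected parts:
  `2·#bdry K + 3·#H + #S + 2·#N₀ ≤ 2·#bdry (K ∪ H) + 2·#D + 2·#{P ∈ parts : P ∩ S = ∅}`;
* `card_centre_add_le_parts` — `H = ∅`: `#S + 2·#N₀ ≤ 2·#D + 2·#{centre-free parts}`;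
* `three_mul_card_centre_le_card`, `nine_le_card` — an X-connected centre structure has `#K ≥ 3·#S + 4·#N₀ ≥ 9`.

With the disconnected-case theorems (`PstarAdditiveSplit`, `PstarSwitchSplit`, `PstarSplitFibre`) this prices the XOR-disconnected centre structures
of the census as well.
-/

set_option linter.dupNamespace false -- `Summit.PneNP.PneNP.…`: summit = sub-problem name (D-0017 single-conjunct layout)

open Finset Literature.Computability.Complexity
open Summit.PneNP.PneNP.Theorems.PstarTyped (Typed)
open Summit.PneNP.PneNP.Theorems.PstarSALevel (varSet bdry BoundaryExpanding SimpleOverlap)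
open Summit.PneNP.PneNP.Theorems.PstarSAClosure (degIn mem_bdry_iff)
open Summit.PneNP.PneNP.Theorems.PstarXCore (xpair mem_xpair xverts)
open Summit.PneNP.PneNP.Theorems.PstarCentreFree (vars_mem_varSet)
open Summit.PneNP.PneNP.Theorems.PstarCoreBound (XorClosed)
open Summit.PneNP.PneNP.Theorems.PstarChordRepair (IsChord)
open Summit.PneNP.PneNP.Theorems.PstarCoreBoundTargets (Terminal nonchords mem_nonchords)
open Summit.PneNP.PneNP.Theorems.PstarSharingBound (sharedSlots card_bdry_add_card_sharedSlots_le)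
open Summit.PneNP.PneNP.Theorems.PstarChordBridgeTools (xpdeg)
open Summit.PneNP.PneNP.Theorems.PstarChordBridgeExchange (mem_xverts_iff)
open Summit.PneNP.PneNP.Theorems.PstarNorUnitCoverTools (exists_ne_of_two_le_xpdeg)
open Summit.PneNP.PneNP.Theorems.PstarChordReadOutside (OutsideGated)
open Summit.PneNP.PneNP.Theorems.PstarNoFreeVertex (covered_of_terminal mem_varSet_of_mem_xpair mem_xpair_of_mem_varSet)
open Summit.PneNP.PneNP.Theorems.PstarSkeletonSpan (XConnected skel mem_skel skel_subset xverts_mono)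
open Summit.PneNP.PneNP.Theorems.PstarSlackTwoTools (card_deg2_chords_le_filter exists_inside_gate not_mem_varSet_gate_of_clean)
open Summit.PneNP.PneNP.Theorems.PstarSlackTwoClean (card_bdry_sdiff_add_le)

open Summit.PneNP.PneNP.Theorems.PstarCentreThreeGates (degIn_union card_bdry_union_le isChord_union_of_clean)
open Summit.PneNP.PneNP.Theorems.PstarGateBudgetTools (card_nonchords_add_le_card_sharedSlots)
open Summit.PneNP.PneNP.Theorems.PstarSkeletonPartsSum (card_xverts_sdiff_add_le_parts)
open Summit.PneNP.PneNP.Theorems.PstarCentreGateBudget (slack_ge_centre)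

namespace Summit.PneNP.PneNP.Theorems.PstarCentreGateBudgetParts

variable {n m : ℕ}

variable {I : LocalMap 4 n m} {r : ℕ} {y : Fin m → Bool} {K : Finset (Fin m)} {w₁ w₂ : Finset (Fin n) × Finset (Fin m) × Bool}

/-- **THE GATE BUDGET OVER THE PARTS** — every slack, all sharing patterns, inside the core-bound induction; `parts` a partition of `K` into
separated X-connected parts: `2·#bdry K + 3·#H + #S + 2·#N₀ ≤ 2·#bdry (K ∪ H) + 2·#D + 2·#{P ∈ parts : P ∩ S = ∅}`. -/
theorem centre_gate_budget_parts (hI : I.IsPure xorAndPred) (hT : Typed I) (hS : SimpleOverlap I) (hB : BoundaryExpanding r I)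
    (ht : Terminal I r y K w₁ w₂)
    (hIH : ∀ c ∈ K, ∀ K₀ ⊆ K.erase c, ∀ d d' : Finset (Fin n) × Finset (Fin m) × Bool, Terminal I r y K₀ d d' → K₀.card ≤ 5)
    (parts : Finset (Finset (Fin m))) (hpK : ∀ P ∈ parts, P ⊆ K) (hpcov : ∀ f ∈ K, ∃ P ∈ parts, f ∈ P)
    (hpdisj : ∀ P ∈ parts, ∀ P' ∈ parts, P ≠ P' → Disjoint P P')
    (hpsep : ∀ P ∈ parts, ∀ f ∈ K, f ∉ P → I.vars f 0 ∉ xverts I P ∧ I.vars f 1 ∉ xverts I P)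
    (hpconn : ∀ P ∈ parts, XConnected I P)
    {S : Finset (Fin m)} (hSK : S ⊆ K) (hSne : S.Nonempty) (hSL : ∀ w ∈ xverts I S, 2 ≤ xpdeg I S w)
    (hSnc : ∀ f ∈ S, ¬ IsChord I K f) {H : Finset (Fin m)} (hHM : H ⊆ w₁.2.1 ∪ w₂.2.1)
    (hHin : ∀ h ∈ H, (∃ j ∈ K, I.vars h 2 ∈ varSet I j) ∧ ∃ j ∈ K, I.vars h 3 ∈ varSet I j)
    {D : Finset (Fin m)} (hD : ∀ d ∈ K, IsChord I K d → ¬ OutsideGated I K (w₁.2.1 ∪ w₂.2.1) d → d ∈ D)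
    {N₀ : Finset (Fin m)} (hN₀K : N₀ ⊆ K) (hN₀ : ∀ f ∈ N₀, I.vars f 2 ∉ bdry I K ∧ I.vars f 3 ∉ bdry I K) :
    2 * (bdry I K).card + 3 * H.card + S.card + 2 * N₀.card ≤
      2 * (bdry I (K ∪ H)).card + 2 * D.card + 2 * (parts.filter fun P => P ∩ S = ∅).card := by
  classical
  have hX : XorClosed I K := ht.2.1
  have hKr : K.card < r := ht.2.2.1
  set M := w₁.2.1 ∪ w₂.2.1 with hM
  have hbs := card_bdry_add_card_sharedSlots_le I K hX
  have hN := card_nonchords_add_le_card_sharedSlots I K hN₀K hN₀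
  -- the skeleton: non-chords and dirty chords; vertex excess over the centre
  have hskel : skel I K M ⊆ nonchords I K ∪ D := by
    intro f hf
    obtain ⟨hfK, hnot⟩ := (mem_skel I).1 hf
    by_cases hch : IsChord I K f
    · exact mem_union_right _ (hD f hfK hch fun hO => hnot ⟨hch, hO⟩)
    · exact mem_union_left _ ((mem_nonchords I).2 ⟨hfK, hch⟩)
  have hskelcard : (skel I K M).card ≤ (nonchords I K).card + D.card := (card_le_card hskel).trans (card_union_le _ _)
  have hu := card_xverts_sdiff_add_le_parts hI hT hS hB ht hIH hSK hSnc parts hpK hpcov hpdisj hpsep hpconn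
  rw [← hM] at hu
  set C := K.filter fun c => IsChord I K c ∧ OutsideGated I K M c with hC
  have hsplit : C.card + (skel I K M).card = K.card := by
    have h1 := card_filter_add_card_filter_not (s := K) (fun c => IsChord I K c ∧ OutsideGated I K M c)
    have e : (K.filter fun c => ¬ (IsChord I K c ∧ OutsideGated I K M c)) = skel I K M := by
      ext f; rw [mem_filter, mem_skel]
    rw [e] at h1
    exact h1
  set C₂ := C.filter fun c => ∃ w ∈ xpair I c, degIn I K w = 2 with hC₂
  set C'' := C.filter fun c => ¬ ∃ w ∈ xpair I c, degIn I K w = 2 with hC''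
  have hCsplit : C₂.card + C''.card = C.card := card_filter_add_card_filter_not _
  have hcov := covered_of_terminal hI hT hS hB ht
  have hC₂mem : ∀ c ∈ C₂, c ∈ K ∧ IsChord I K c ∧ OutsideGated I K M c ∧ ∃ w ∈ xpair I c, degIn I K w = 2 := fun c hc => by
    obtain ⟨hcC, hw⟩ := mem_filter.1 hc
    obtain ⟨hcK, hch, hO⟩ := mem_filter.1 hcC
    exact ⟨hcK, hch, hO, hw⟩
  -- refined injection: `#C'' ≥ t + #S + 2·#N₀ − 2·#𝒟 + #Y`
  set Y := (xverts I K \ xverts I S).filter fun v => ¬ degIn I K v = 2 with hY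
  have hC₂f := card_deg2_chords_le_filter I hI hcov hC₂mem hSK hSL hSnc
  have hYsplit : ((xverts I K \ xverts I S).filter fun v => degIn I K v = 2).card + Y.card = (xverts I K \ xverts I S).card :=
    card_filter_add_card_filter_not _
  have hC''5 : 2 * (bdry I K).card + S.card + 2 * N₀.card + Y.card ≤
      C''.card + 3 * K.card + 2 * D.card + 2 * (parts.filter fun P => P ∩ S = ∅).card := by omega
  -- members and fat chords at a vertex
  have memC'' : ∀ c ∈ C'', c ∈ K ∧ IsChord I K c ∧ OutsideGated I K M c ∧ ∀ w ∈ xpair I c, degIn I K w ≠ 2 := fun c hc => by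
    obtain ⟨hcC, hno⟩ := mem_filter.1 hc
    obtain ⟨hcK, hch, hO⟩ := mem_filter.1 hcC
    push Not at hno
    exact ⟨hcK, hch, hO, hno⟩
  -- at every XOR vertex: the fat chords reading it plus one non-clean member
  have fat_lt : ∀ w ∈ xverts I K, (C''.filter fun j => w ∈ varSet I j).card + 1 ≤ degIn I K w := by
    intro w hw
    obtain ⟨f, hf, hwf, hnot⟩ := hcov w hw
    unfold PstarSAClosure.degIn
    have hfC : f ∉ C''.filter fun j => w ∈ varSet I j := fun h => by
      obtain ⟨-, hch, hO, -⟩ := memC'' f (mem_filter.1 h).1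
      exact hnot ⟨hch, hO⟩
    calc (C''.filter fun j => w ∈ varSet I j).card + 1 = (insert f (C''.filter fun j => w ∈ varSet I j)).card := by
          rw [card_insert_of_notMem hfC]
      _ ≤ (K.filter fun j => w ∈ varSet I j).card := by
          refine card_le_card fun j hj => ?_
          rcases mem_insert.1 hj with rfl | hj
          · exact mem_filter.2 ⟨hf, mem_varSet_of_mem_xpair hwf⟩
          · obtain ⟨hjC, hwj⟩ := mem_filter.1 hj
            exact mem_filter.2 ⟨(memC'' j hjC).1, hwj⟩
  -- `W₁`: the vertices all of whose members but one are fat chords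
  set W₁ := (xverts I K).filter fun w => degIn I K w = (C''.filter fun j => w ∈ varSet I j).card + 1 with hW₁
  have hW₁fat : ∀ w ∈ W₁, ∃ c ∈ C'', w ∈ varSet I c := by
    intro w hw
    obtain ⟨hwK, hdw⟩ := mem_filter.1 hw
    by_contra h
    push Not at h
    have h0 : (C''.filter fun j => w ∈ varSet I j).card = 0 := card_eq_zero.2 (filter_eq_empty_iff.2 fun j hj hwj => h j hj hwj)
    rw [h0] at hdw
    -- degree one: an XOR vertex of `K` on the boundary
    obtain ⟨f, hf, hwf⟩ := (mem_xverts_iff I K w).1 hwK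
    have hb : w ∈ bdry I K := (mem_bdry_iff I K w).2 hdw
    rcases (mem_xpair I).1 hwf with h | h
    · exact hX f hf 0 (by decide) (h ▸ hb)
    · exact hX f hf 1 (by decide) (h ▸ hb)
  -- `W₁ ⊆ Y`
  have hW₁Y : W₁ ⊆ Y := by
    intro w hw
    obtain ⟨hwK, hdw⟩ := mem_filter.1 hw
    obtain ⟨c, hc, hwc⟩ := hW₁fat w hw
    obtain ⟨hcK, hch, hO, hno⟩ := memC'' c hc
    have hwx : w ∈ xpair I c := by
      obtain ⟨f, hf, hwf⟩ := (mem_xverts_iff I K w).1 hwK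
      rcases (mem_xpair I).1 hwf with h | h
      · rw [h]; exact mem_xpair_of_mem_varSet hT (s := 0) (by decide) (h ▸ hwc)
      · rw [h]; exact mem_xpair_of_mem_varSet hT (s := 1) (by decide) (h ▸ hwc)
    refine mem_filter.2 ⟨mem_sdiff.2 ⟨hwK, fun hwS => ?_⟩, hno w hwx⟩
    -- a centre vertex carries two members of `S`, which are not fat chords
    obtain ⟨s₁, hs₁, -, hws₁⟩ := exists_ne_of_two_le_xpdeg I hI c (hSL w hwS)
    obtain ⟨s₂, hs₂, hs₂₁, hws₂⟩ := exists_ne_of_two_le_xpdeg I hI s₁ (hSL w hwS)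
    have hsC : ∀ s ∈ S, s ∉ C''.filter fun j => w ∈ varSet I j := fun s hs h =>
      hSnc s hs (memC'' s (mem_filter.1 h).1).2.1
    have hle : (C''.filter fun j => w ∈ varSet I j).card + 2 ≤ degIn I K w := by
      unfold PstarSAClosure.degIn
      have hs₁f : s₁ ∉ C''.filter fun j => w ∈ varSet I j := hsC s₁ hs₁
      have hs₂f : s₂ ∉ insert s₁ (C''.filter fun j => w ∈ varSet I j) := fun h => by
        rcases mem_insert.1 h with h | h
        · exact hs₂₁ h
        · exact hsC s₂ hs₂ h
      calc (C''.filter fun j => w ∈ varSet I j).card + 2 = (insert s₂ (insert s₁ (C''.filter fun j => w ∈ varSet I j))).card := by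
            rw [card_insert_of_notMem hs₂f, card_insert_of_notMem hs₁f]
        _ ≤ (K.filter fun j => w ∈ varSet I j).card := by
            refine card_le_card fun j hj => ?_
            rcases mem_insert.1 hj with rfl | hj
            · exact mem_filter.2 ⟨hSK hs₂, mem_varSet_of_mem_xpair hws₂⟩
            rcases mem_insert.1 hj with rfl | hj
            · exact mem_filter.2 ⟨hSK hs₁, mem_varSet_of_mem_xpair hws₁⟩
            · obtain ⟨hjC, hwj⟩ := mem_filter.1 hj
              exact mem_filter.2 ⟨(memC'' j hjC).1, hwj⟩
    omega
  -- keep one fat chord at each vertex of `W₁`, delete the other fat chords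
  choose κ hκC hκw using hW₁fat
  obtain ⟨s₀, hs₀⟩ := hSne
  set kf : Fin n → Fin m := fun w => if h : w ∈ W₁ then κ w h else s₀ with hkf
  set Kept := W₁.image kf with hKept
  have hKeptC : Kept ⊆ C'' := by
    intro j hj
    obtain ⟨w, hw, rfl⟩ := mem_image.1 hj
    simp only [hkf, dif_pos hw]
    exact hκC w hw
  have hKeptW : Kept.card ≤ W₁.card := card_image_le
  set R := C'' \ Kept with hR
  have hRK : R ⊆ K := fun j hj => (memC'' j (mem_sdiff.1 hj).1).1
  have hRch : ∀ c ∈ R, IsChord I K c := fun j hj => (memC'' j (mem_sdiff.1 hj).1).2.1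
  have hRdeg : ∀ c ∈ R, ∀ w ∈ xpair I c, 2 + (R.filter fun j => w ∈ varSet I j).card ≤ degIn I K w := by
    intro c hc w hw
    have hcC'' : c ∈ C'' := (mem_sdiff.1 hc).1
    have hwK : w ∈ xverts I K := (mem_xverts_iff I K w).2 ⟨c, (memC'' c hcC'').1, hw⟩
    have hsub : (R.filter fun j => w ∈ varSet I j) ⊆ C''.filter fun j => w ∈ varSet I j := filter_subset_filter _ sdiff_subset
    have hfl := fat_lt w hwK
    by_cases hwW : w ∈ W₁
    · -- the kept chord at `w` is fat, reads `w`, and is not deleted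
      have hkw : kf w ∈ C''.filter fun j => w ∈ varSet I j := by
        simp only [hkf, dif_pos hwW]
        exact mem_filter.2 ⟨hκC w hwW, hκw w hwW⟩
      have hkR : kf w ∉ R.filter fun j => w ∈ varSet I j := fun h =>
        (mem_sdiff.1 (mem_filter.1 h).1).2 (mem_image.2 ⟨w, hwW, rfl⟩)
      have hlt : (R.filter fun j => w ∈ varSet I j).card < (C''.filter fun j => w ∈ varSet I j).card :=
        card_lt_card ⟨hsub, fun h => hkR (h hkw)⟩
      have := (mem_filter.1 hwW).2
      omega
    · have hne : degIn I K w ≠ (C''.filter fun j => w ∈ varSet I j).card + 1 := fun h => hwW (mem_filter.2 ⟨hwK, h⟩)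
      have := card_le_card hsub
      omega
  -- the deletion, run in the gated family `F = K ∪ H`
  have hdisj : Disjoint K M := disjoint_union_right.2 ⟨ht.2.2.2.1, ht.2.2.2.2.1⟩
  have hKH : Disjoint K H := hdisj.mono_right hHM
  set F := K ∪ H with hF
  have hRF : R ⊆ F := hRK.trans subset_union_left
  have hRchF : ∀ c ∈ R, IsChord I F c := fun c hc =>
    isChord_union_of_clean I hT hKH hHM hHin (memC'' c (mem_sdiff.1 hc).1).2.1 (memC'' c (mem_sdiff.1 hc).1).2.2.1
  have hRdegF : ∀ c ∈ R, ∀ w ∈ xpair I c, 2 + (R.filter fun j => w ∈ varSet I j).card ≤ degIn I F w := fun c hc w hw => by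
    have h1 := hRdeg c hc w hw
    rw [hF, degIn_union I hKH]
    omega
  have hdel := card_bdry_sdiff_add_le I hI F R hRF hRchF hRdegF
  have hFr : (F \ R).card ≤ r := by
    refine le_trans (card_le_card fun f hf => ?_) ht.2.2.2.2.2.1
    rcases mem_union.1 (mem_sdiff.1 hf).1 with h | h
    · exact mem_union_left _ (mem_union_left _ h)
    · rw [union_assoc]; exact mem_union_right _ (hHM h)
  have hexp := hB (F \ R) hFr
  have hFR : (F \ R).card + R.card = F.card := card_sdiff_add_card_eq_card hRF
  have hFcard : F.card = K.card + H.card := by rw [hF, card_union_of_disjoint hKH]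
  have hRcard : R.card + Kept.card = C''.card := by rw [hR, card_sdiff_add_card_eq_card hKeptC]
  have hWY := card_le_card hW₁Y
  omega

/-- **`H = ∅`**: `#S + 2·#N₀ ≤ 2·#D + 2·#{centre-free parts}`. -/
theorem card_centre_add_le_parts (hI : I.IsPure xorAndPred) (hT : Typed I) (hS : SimpleOverlap I) (hB : BoundaryExpanding r I)
    (ht : Terminal I r y K w₁ w₂)
    (hIH : ∀ c ∈ K, ∀ K₀ ⊆ K.erase c, ∀ d d' : Finset (Fin n) × Finset (Fin m) × Bool, Terminal I r y K₀ d d' → K₀.card ≤ 5)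
    (parts : Finset (Finset (Fin m))) (hpK : ∀ P ∈ parts, P ⊆ K) (hpcov : ∀ f ∈ K, ∃ P ∈ parts, f ∈ P)
    (hpdisj : ∀ P ∈ parts, ∀ P' ∈ parts, P ≠ P' → Disjoint P P')
    (hpsep : ∀ P ∈ parts, ∀ f ∈ K, f ∉ P → I.vars f 0 ∉ xverts I P ∧ I.vars f 1 ∉ xverts I P)
    (hpconn : ∀ P ∈ parts, XConnected I P)
    {S : Finset (Fin m)} (hSK : S ⊆ K) (hSne : S.Nonempty) (hSL : ∀ w ∈ xverts I S, 2 ≤ xpdeg I S w)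
    (hSnc : ∀ f ∈ S, ¬ IsChord I K f)
    {D : Finset (Fin m)} (hD : ∀ d ∈ K, IsChord I K d → ¬ OutsideGated I K (w₁.2.1 ∪ w₂.2.1) d → d ∈ D)
    {N₀ : Finset (Fin m)} (hN₀K : N₀ ⊆ K) (hN₀ : ∀ f ∈ N₀, I.vars f 2 ∉ bdry I K ∧ I.vars f 3 ∉ bdry I K) :
    S.card + 2 * N₀.card ≤ 2 * D.card + 2 * (parts.filter fun P => P ∩ S = ∅).card := by
  have h := centre_gate_budget_parts hI hT hS hB ht hIH parts hpK hpcov hpdisj hpsep hpconn hSK hSne hSL hSnc (H := ∅) (empty_subset _)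
    (fun _ h => absurd h (notMem_empty _)) hD hN₀K hN₀
  rw [union_empty, card_empty] at h
  omega

/-- **AN X-CONNECTED CENTRE STRUCTURE HAS AT LEAST `3·#S + 4·#N₀ ≥ 9` MEMBERS** (inside the induction): from `slack_ge_centre`,
`#bdry + #sharedSlots ≤ 2·#K` and `#nonchords + #N₀ ≤ #sharedSlots`. -/
theorem three_mul_card_centre_le_card (hI : I.IsPure xorAndPred) (hT : Typed I) (hS : SimpleOverlap I) (hB : BoundaryExpanding r I)
    (ht : Terminal I r y K w₁ w₂)
    (hIH : ∀ c ∈ K, ∀ K₀ ⊆ K.erase c, ∀ d d' : Finset (Fin n) × Finset (Fin m) × Bool, Terminal I r y K₀ d d' → K₀.card ≤ 5)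
    (hconn : XConnected I K) {S : Finset (Fin m)} (hSK : S ⊆ K) (hSne : S.Nonempty) (hSL : ∀ w ∈ xverts I S, 2 ≤ xpdeg I S w)
    (hSnc : ∀ f ∈ S, ¬ IsChord I K f)
    {N₀ : Finset (Fin m)} (hN₀K : N₀ ⊆ K) (hN₀ : ∀ f ∈ N₀, I.vars f 2 ∉ bdry I K ∧ I.vars f 3 ∉ bdry I K) :
    3 * S.card + 4 * N₀.card ≤ K.card := by
  have h1 := slack_ge_centre hI hT hS hB ht hIH hconn hSK hSne hSL hSnc hN₀K hN₀
  have h2 := card_bdry_add_card_sharedSlots_le I K ht.2.1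
  have h3 := card_nonchords_add_le_card_sharedSlots I K hN₀K hN₀
  have h4 : S.card ≤ (nonchords I K).card := card_le_card fun f hf => (mem_nonchords I).2 ⟨hSK hf, hSnc f hf⟩
  omega

/-- In particular an X-connected terminal core with a centre has at least nine members (inside the induction). -/
theorem nine_le_card (hI : I.IsPure xorAndPred) (hT : Typed I) (hS : SimpleOverlap I) (hB : BoundaryExpanding r I)
    (ht : Terminal I r y K w₁ w₂)
    (hIH : ∀ c ∈ K, ∀ K₀ ⊆ K.erase c, ∀ d d' : Finset (Fin n) × Finset (Fin m) × Bool, Terminal I r y K₀ d d' → K₀.card ≤ 5)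
    (hconn : XConnected I K) (hcentre : ∃ S ⊆ K, S.Nonempty ∧ (∀ w ∈ xverts I S, 2 ≤ xpdeg I S w) ∧ ∀ f ∈ S, ¬ IsChord I K f) :
    9 ≤ K.card := by
  obtain ⟨S, hSK, hSne, hSL, hSnc⟩ := hcentre
  have h1 := three_mul_card_centre_le_card hI hT hS hB ht hIH hconn hSK hSne hSL hSnc (N₀ := ∅) (empty_subset _)
    (fun _ h => absurd h (notMem_empty _))
  have h4 : 3 ≤ S.card := PstarNorUnitCoverTools.three_le_card_of_leafless I hI hS hSne hSL
  omega

end Summit.PneNP.PneNP.Theorems.PstarCentreGateBudgetParts
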